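import Literature.Probability.Percolation.KSTPeriodicQuasi
import Literature.Probability.Percolation.KSTPeriodicClosing
import HarnessLib

/-!
# Stub `stub_kstQuasi` of line `finite-size-envelope`, crux `CriticalPathRSW` (stmt-CriticalPhenomena-10267)

[KohlerSchindlerTassion2023, Lemmas 3 and 5 with Comment 1] in weak periodic form, for
`kℤ² ⋊ D₄`-periodic positively associated bond measures on `ℤ²` carried by lattice
configurations (`KSTPeriodic.Admissible`, `Literature/Probability/Percolation/KSTPeriodicDefs.lean`):

* `KSTPeriodic.QuasiOfArms k t` (Lemma 3: arms give quasi-crossings between adjacent scales),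
  granted the planar facts `TopSideToLeftMeetsTB`, `TopSideToRightMeetsTB`, `AlternatingTBMeet`
  (stub `kstTopology`) and the corridor lemma `CorridorA` (stub `kstCorridor`) — the Literature
  theorem `KSTPeriodic.quasiOfArms_of` (`KSTPeriodicQuasi.lean`, constant `s₀ = a₀ ^ 6`,
  threshold `N₂ = N₁ + 128t + 1`; walk combinatorics in `KSTPeriodicQuasiFence.lean`,
  `KSTPeriodicQuasiWalls.lean`);
* `KSTPeriodic.ClosingIneq k t` (Lemma 5: `μ(𝓠(n, m)) μ(𝓑(m)) ≤ μ(𝓑(n))`), granted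
  `PartsMeetMPath` (stub `kstTopology`) — the Literature theorem `KSTPeriodic.closingIneq_of`
  (`KSTPeriodicClosing.lean`).

The hypothesis `1 ≤ k` of the registered signature is not needed.
-/

namespace Summit.CriticalPhenomena.CardyFormulaZ2.Cruxes.CriticalPathRSW.FiniteSizeEnvelope

open Literature.Probability.Percolation

/-- **Registered stub `stub_kstQuasi`** of the line `finite-size-envelope`: Lemma 3 (arms give
quasi-crossings, `QuasiOfArms`) and Lemma 5 (the closing inequality, `ClosingIneq`) of the weak
periodic RSW theorem, granted the planar facts and the corridor lemma.
[cite: KohlerSchindlerTassion2023, Lemma 3, Lemma 5 and Comment 1] -/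
theorem stub_kstQuasi :
  ∀ k t : ℕ, 1 ≤ k → KSTPeriodic.PartsMeetMPath → KSTPeriodic.TopSideToLeftMeetsTB →
    KSTPeriodic.TopSideToRightMeetsTB → KSTPeriodic.AlternatingTBMeet → KSTPeriodic.CorridorA →
    KSTPeriodic.QuasiOfArms k t ∧ KSTPeriodic.ClosingIneq k t :=
  fun k t _ hPM hTL hTR hAlt hCo =>
    ⟨KSTPeriodic.quasiOfArms_of hTL hTR hAlt hCo, KSTPeriodic.closingIneq_of hPM k t⟩

end Summit.CriticalPhenomena.CardyFormulaZ2.Cruxes.CriticalPathRSW.FiniteSizeEnvelope
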